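import Summits.CriticalPhenomena.PercolationContinuityZ3.Theorems.Transplant.FKConnectivityAllQAntipodalAnd4Series
import HarnessLib

/-!
# Connectivity correlation inequalities for `φ_{w,q}`, every `q > 0` — file 27a: `C_∞(and_S)` FOR THE 3-EDGE PATH `S = P₄` ACROSS A SERIES JUNCTION
# — the bridge to `apPsi`, the side inputs from Theorem U / the |W| = 3 theorem, and the assembled theorem

Support file (`--supports stmt-CriticalPhenomena-4575`), FK sub-lane `prim-bschramm-fk-2` (gen 18) of the post-continuity programme; builds
on p205010 (kernel theorem, internal audit signed; external expert review pending).  No definitions, no named facts, no sorries; standard axioms.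

`…AntipodalAnd4Series.lean` proved the abstract series-junction theorem `FK.and4_series_nonpos`: the AND-drift
`∑_{γ ⊆ N} (q^{k(γ∪S)+k(N\γ)} - q^{k((N\γ)∪S)+k(γ)}) g(γ)` of `S = {ab, bc, cd}` on a one-point union `N = N₁ ⊔_m N₂` is `≤ 0` as soon as the
|W| = 3 AND-drifts for `(a,b,m)`, `(d,c,m)` and the single-edge drifts for `ab`, `cd` are `≤ 0` on the sides.  This file supplies:
* `FK.apPsi_andInd_eq` — the BRIDGE: for `S` disjoint from `N` and `g` not reading `S`, `apPsi q (N ∪ S) 1_{S ⊆ ·} g = 2 · (AND-drift)` (any `S ≠ ∅`);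
* `FK.and2_side_nonpos`, `FK.and1_side_nonpos` — the side inputs for a two-terminal series–parallel `E` between `s, t` with `st ∉ E`, `uv ∈ E`,
  `N = E \ {uv}`: the |W| = 3 drift for `{uv, st}` (gen 11's `apPsi_two_edges_nonpos_of_isTTSP`) and the `uv`-drift (Theorem U at `uv` on the
  sub-network `N` of `E ∪ {st}` re-rooted at `uv`: `IsTTSP.reroot` + `apPsi_edge_nonpos_of_isTTSP`), both through the bridge;
* **`FK.apPsi_and_path3_series_nonpos`** — for `A₁ = N₁ ∪ {ab}` TTSP between `b, m` and `A₂ = N₂ ∪ {cd}` TTSP between `m, c`, edge-disjoint and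
  meeting only in `m` (`b` off `A₂`, `c` off `A₁`), without the junction edges `bm`, `mc`, and `H = A₁ ∪ A₂ ∪ {bc}`:
  `apPsi q H 1_{{ab,bc,cd} ⊆ ·} g ≤ 0` for every `0 < q ≤ 1` and every increasing `g` on `N₁ ∪ N₂` not reading `ab, bc, cd` — gen 10's Conjecture
  `C_∞` for the AND type on a 3-edge PATH whose middle-edge complement `H \ bc` is a series composition: the first level-3 case of `C_∞` beyond the
  triangle (gen 17), i.e. every square-free coefficient of `Z_H² Cov_{φ_{z,q}}(ω_{ab}ω_{bc}ω_{cd}, g)` is `≤ 0` there.  (Parallel junction: the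
  analogous identity with Theorem U on the `bc`-contracted sides, memo `bschramm/FROM-fk-2-g18-AND-WORDHALL.md` §7A — next file.)
[cite: Grimmett2006, §1.4 eq. (1.20) (p. 15); §3.8 Thm. (3.90) (pp. 61–62); §3.9 (pp. 63–64)] [cite: Wagner2006, Thm. 5.8(d), §5.3]
-/

noncomputable section

namespace Summit.CriticalPhenomena.PercolationContinuityZ3.Theorems

namespace FK

open SimpleGraph Literature.Probability.LatticeModels Literature.Probability.Percolation
open scoped Classical

variable {V : Type*} [Fintype V]

/-! ### The bridge to the antipodal covariance form -/

section Bridge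

omit [Fintype V] in
/-- `γ ∪ {x, y}` as two insertions. [folklore] -/
theorem union_pair_eq_insert (γ : Finset (Sym2 V)) (x y : Sym2 V) : γ ∪ {x, y} = insert y (insert x γ) := by
  ext e; simp only [Finset.mem_union, Finset.mem_insert, Finset.mem_singleton]; tauto

omit [Fintype V] in
/-- `γ ∪ {x}` as an insertion. [folklore] -/
theorem union_singleton_eq_insert (γ : Finset (Sym2 V)) (x : Sym2 V) : γ ∪ {x} = insert x γ := by
  ext e; simp only [Finset.mem_union, Finset.mem_insert, Finset.mem_singleton]; tauto

/-- **Bridge.**  For `S` disjoint from `N`, nonempty, and `g` not reading `S`: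
`apPsi q (N ∪ S) 1_{S ⊆ ·} g = 2 · ∑_{γ ⊆ N} (q^{k(γ∪S)+k(N\γ)} - q^{k((N\γ)∪S)+k(γ)}) g(γ)` — the AND-drift of `S` (gen 17's `a_S`, doubled).
[cite: Grimmett2006, §1.4 eq. (1.20) (p. 15); §3.8 (pp. 61–62)] -/
theorem apPsi_andInd_eq (q : ℝ) {N S : Finset (Sym2 V)} (hNS : Disjoint N S) (hS : S.Nonempty)
    {g : Finset (Sym2 V) → ℝ} (hg : ∀ A T : Finset (Sym2 V), T ⊆ S → g (A ∪ T) = g A) :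
    apPsi q (N ∪ S) (fun A => if S ⊆ A then 1 else 0) g =
      2 * ∑ γ ∈ N.powerset, (q ^ (clusterCount (↑(γ ∪ S) : BondConfig V) ∅ + clusterCount (↑(N \ γ) : BondConfig V) ∅) - q ^ (clusterCount (↑(N \ γ ∪ S) : BondConfig V) ∅ + clusterCount (↑γ : BondConfig V) ∅)) * g γ := by
  unfold apPsi
  rw [sum_powerset_union_disj hNS]
  have hS0 : S ≠ ∅ := Finset.nonempty_iff_ne_empty.1 hS
  -- the inner sum over `ε ⊆ S` has exactly two nonzero terms, `ε = S` and `ε = ∅`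
  have inner : ∀ γ ∈ N.powerset,
      ∑ ε ∈ S.powerset, q ^ apExp (N ∪ S) (γ ∪ ε) *
          (((if S ⊆ γ ∪ ε then (1 : ℝ) else 0) - (if S ⊆ (N ∪ S) \ (γ ∪ ε) then 1 else 0)) *
            (g (γ ∪ ε) - g ((N ∪ S) \ (γ ∪ ε)))) =
        (q ^ (clusterCount (↑(γ ∪ S) : BondConfig V) ∅ + clusterCount (↑(N \ γ) : BondConfig V) ∅) - q ^ (clusterCount (↑(N \ γ ∪ S) : BondConfig V) ∅ + clusterCount (↑γ : BondConfig V) ∅)) *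
          (g γ - g (N \ γ)) := by
    intro γ hγ
    rw [Finset.mem_powerset] at hγ
    have hγS : Disjoint γ S := Finset.disjoint_of_subset_left hγ hNS
    rw [Finset.sum_eq_add_of_mem S ∅ (Finset.mem_powerset.2 le_rfl) (Finset.mem_powerset.2 (Finset.empty_subset _)) hS0 ?_]
    · -- the two surviving terms
      simp only [Finset.union_empty]
      have c1 : (N ∪ S) \ (γ ∪ S) = N \ γ := by
        rw [union_sdiff_union hNS hγ le_rfl, sdiff_self, Finset.bot_eq_empty, Finset.union_empty]
      have c2 : (N ∪ S) \ γ = N \ γ ∪ S := by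
        rw [Finset.union_sdiff_distrib, hγS.symm.sdiff_eq_left]
      have t1 : S ⊆ γ ∪ S := Finset.subset_union_right
      have t2 : ¬ S ⊆ N \ γ := fun h => hS0 (Finset.subset_empty.1 fun e he =>
        (Finset.disjoint_left.1 hNS (Finset.mem_sdiff.1 (h he)).1 he).elim)
      have t3 : ¬ S ⊆ γ := fun h => hS0 (Finset.subset_empty.1 fun e he => (Finset.disjoint_left.1 hγS (h he) he).elim)
      have t4 : S ⊆ N \ γ ∪ S := Finset.subset_union_right
      rw [c1, c2, if_pos t1, if_neg t2, if_neg t3, if_pos t4, hg γ S le_rfl, hg (N \ γ) S le_rfl]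
      unfold apExp
      rw [c1, c2]
      ring
    · -- the other terms vanish
      intro ε hε hne
      rw [Finset.mem_powerset] at hε
      have n1 : ¬ S ⊆ γ ∪ ε := fun h => hne.1 (le_antisymm hε fun e he => by
        rcases Finset.mem_union.1 (h he) with h' | h'
        · exact (Finset.disjoint_left.1 hγS h' he).elim
        · exact h')
      have n2 : ¬ S ⊆ (N ∪ S) \ (γ ∪ ε) := fun h => hne.2 (Finset.eq_empty_of_forall_notMem fun e he => by
        have := Finset.mem_sdiff.1 (h (hε he)); exact this.2 (Finset.mem_union_right _ he))
      rw [if_neg n1, if_neg n2, sub_self, zero_mul, mul_zero]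
  rw [Finset.sum_congr rfl inner]
  -- symmetrise: the `g(N \ γ)` half is the `g γ` half after `γ ↦ N \ γ`
  have flip := sum_powerset_flip N (fun γ =>
    (q ^ (clusterCount (↑(γ ∪ S) : BondConfig V) ∅ + clusterCount (↑(N \ γ) : BondConfig V) ∅) - q ^ (clusterCount (↑(N \ γ ∪ S) : BondConfig V) ∅ + clusterCount (↑γ : BondConfig V) ∅)) * g (N \ γ))
  have flip' : ∑ γ ∈ N.powerset, (q ^ (clusterCount (↑(γ ∪ S) : BondConfig V) ∅ + clusterCount (↑(N \ γ) : BondConfig V) ∅) - q ^ (clusterCount (↑(N \ γ ∪ S) : BondConfig V) ∅ + clusterCount (↑γ : BondConfig V) ∅)) * g (N \ γ) =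
      - ∑ γ ∈ N.powerset, (q ^ (clusterCount (↑(γ ∪ S) : BondConfig V) ∅ + clusterCount (↑(N \ γ) : BondConfig V) ∅) - q ^ (clusterCount (↑(N \ γ ∪ S) : BondConfig V) ∅ + clusterCount (↑γ : BondConfig V) ∅)) * g γ := by
    rw [flip, ← Finset.sum_neg_distrib]
    refine Finset.sum_congr rfl fun γ hγ => ?_
    rw [Finset.mem_powerset] at hγ
    rw [Finset.sdiff_sdiff_eq_self hγ]
    ring
  have split : ∑ γ ∈ N.powerset, (q ^ (clusterCount (↑(γ ∪ S) : BondConfig V) ∅ + clusterCount (↑(N \ γ) : BondConfig V) ∅) - q ^ (clusterCount (↑(N \ γ ∪ S) : BondConfig V) ∅ + clusterCount (↑γ : BondConfig V) ∅)) * (g γ - g (N \ γ)) =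
      ∑ γ ∈ N.powerset, (q ^ (clusterCount (↑(γ ∪ S) : BondConfig V) ∅ + clusterCount (↑(N \ γ) : BondConfig V) ∅) - q ^ (clusterCount (↑(N \ γ ∪ S) : BondConfig V) ∅ + clusterCount (↑γ : BondConfig V) ∅)) * g γ -
        ∑ γ ∈ N.powerset, (q ^ (clusterCount (↑(γ ∪ S) : BondConfig V) ∅ + clusterCount (↑(N \ γ) : BondConfig V) ∅) - q ^ (clusterCount (↑(N \ γ ∪ S) : BondConfig V) ∅ + clusterCount (↑γ : BondConfig V) ∅)) * g (N \ γ) := by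
    rw [← Finset.sum_sub_distrib]; refine Finset.sum_congr rfl fun γ _ => ?_; ring
  rw [split, flip']
  ring

end Bridge

/-! ### The side inputs from two-terminal series–parallel structure, and the theorem for `S = P₄` across a series junction -/

section Sides

variable {s t u v : V}

/-- **Side input Y (the |W| = 3 AND-drift of a side).**  `E` TTSP between `s, t`, `st ∉ E`, `uv ∈ E`, `N = E \ {uv}`: for every `h`
monotone on the subsets of `N`, `∑_{γ ⊆ N} (q^{k(γ ∪ {uv, st}) + k(N\γ)} - q^{k((N\γ) ∪ {uv, st}) + k(γ)}) h(γ) ≤ 0` (`0 < q ≤ 1`) — gen 11's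
`apPsi_two_edges_nonpos_of_isTTSP` through the bridge. [cite: Grimmett2006, §3.9 (pp. 63–64)] [cite: Wagner2006, Thm. 5.8(d), §5.3] -/
theorem and2_side_nonpos {q : ℝ} (hq0 : 0 < q) (hq1 : q ≤ 1) {E : Finset (Sym2 V)} (hE : IsTTSP E s t) (hst : s(s, t) ∉ E)
    (huv : s(u, v) ∈ E) {h : Finset (Sym2 V) → ℝ}
    (hmono : ∀ ⦃A B : Finset (Sym2 V)⦄, A ⊆ B → B ⊆ E.erase s(u, v) → h A ≤ h B) :
    ∑ γ ∈ (E.erase s(u, v)).powerset,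
        (q ^ (clusterCount (↑(insert s(s, t) (insert s(u, v) γ)) : BondConfig V) ∅ + clusterCount (↑(E.erase s(u, v) \ γ) : BondConfig V) ∅) -
            q ^ (clusterCount (↑(insert s(s, t) (insert s(u, v) (E.erase s(u, v) \ γ))) : BondConfig V) ∅ + clusterCount (↑γ : BondConfig V) ∅)) * h γ ≤ 0 := by
  set N := E.erase s(u, v) with hN
  have huvN : s(u, v) ∉ N := Finset.notMem_erase _ _
  have hstN : s(s, t) ∉ N := fun h => hst (Finset.mem_of_mem_erase h)
  have hne : s(u, v) ≠ s(s, t) := fun h => hst (h ▸ huv)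
  -- the extended test function
  set G : Finset (Sym2 V) → ℝ := fun X => h (X ∩ N) with hG
  have hGmono : ∀ ⦃A B : Finset (Sym2 V)⦄, A ⊆ B → B ⊆ insert s(s, t) E → G A ≤ G B := fun A B hAB _ =>
    hmono (Finset.inter_subset_inter hAB le_rfl) Finset.inter_subset_right
  have hGx : ∀ A : Finset (Sym2 V), G (insert s(s, t) A) = G A := fun A => by
    simp only [hG, Finset.insert_inter_of_notMem hstN]
  have hGy : ∀ A : Finset (Sym2 V), G (insert s(u, v) A) = G A := fun A => by
    simp only [hG, Finset.insert_inter_of_notMem huvN]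
  have key := apPsi_two_edges_nonpos_of_isTTSP hq0 hq1 hE hst huv hGx hGy hGmono
  -- rewrite it through the bridge
  have hNS : Disjoint N {s(u, v), s(s, t)} := by
    rw [Finset.disjoint_insert_right, Finset.disjoint_singleton_right]; exact ⟨huvN, hstN⟩
  have hE' : insert s(s, t) E = N ∪ {s(u, v), s(s, t)} := by
    rw [union_pair_eq_insert, hN, Finset.insert_erase huv]
  have hf : (fun A : Finset (Sym2 V) => if s(s, t) ∈ A ∧ s(u, v) ∈ A then (1 : ℝ) else 0) =
      fun A => if ({s(u, v), s(s, t)} : Finset (Sym2 V)) ⊆ A then 1 else 0 := by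
    funext A
    simp only [Finset.insert_subset_iff, Finset.singleton_subset_iff, and_comm]
  have hg' : ∀ A T : Finset (Sym2 V), T ⊆ {s(u, v), s(s, t)} → G (A ∪ T) = G A := by
    intro A T hT
    simp only [hG, Finset.union_inter_distrib_right]
    have : T ∩ N = ∅ := Finset.disjoint_iff_inter_eq_empty.1 (Finset.disjoint_of_subset_left hT hNS.symm)
    rw [this, Finset.union_empty]
  rw [hE', hf, apPsi_andInd_eq q hNS ⟨s(u, v), Finset.mem_insert_self _ _⟩ hg'] at key
  have hsum : ∑ γ ∈ N.powerset,
      (q ^ (clusterCount (↑(insert s(s, t) (insert s(u, v) γ)) : BondConfig V) ∅ + clusterCount (↑(N \ γ) : BondConfig V) ∅) -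
          q ^ (clusterCount (↑(insert s(s, t) (insert s(u, v) (N \ γ))) : BondConfig V) ∅ + clusterCount (↑γ : BondConfig V) ∅)) * h γ =
      ∑ γ ∈ N.powerset, (q ^ (clusterCount (↑(γ ∪ {s(u, v), s(s, t)}) : BondConfig V) ∅ + clusterCount (↑(N \ γ) : BondConfig V) ∅) -
          q ^ (clusterCount (↑(N \ γ ∪ {s(u, v), s(s, t)}) : BondConfig V) ∅ + clusterCount (↑γ : BondConfig V) ∅)) * G γ := by
    refine Finset.sum_congr rfl fun γ hγ => ?_
    rw [Finset.mem_powerset] at hγ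
    rw [union_pair_eq_insert, union_pair_eq_insert]
    simp only [hG, Finset.inter_eq_left.2 hγ]
  rw [hsum]
  linarith

/-- **Side input U (the single-edge drift of a side).**  `E` TTSP between `s, t`, `st ∉ E`, `uv ∈ E`, `N = E \ {uv}`: for every `h` monotone
on the subsets of `N`, `∑_{γ ⊆ N} (q^{k(γ ∪ {uv}) + k(N\γ)} - q^{k((N\γ) ∪ {uv}) + k(γ)}) h(γ) ≤ 0` (`0 < q ≤ 1`) — Theorem U at the edge `uv` of the
sub-network `N` of `E ∪ {st}` re-rooted at `uv` (`IsTTSP.reroot`, `apPsi_edge_nonpos_of_isTTSP`) through the bridge.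
[cite: Grimmett2006, §3.9 (pp. 63–64)] [cite: Wagner2006, Thm. 5.8(d), §5.3] -/
theorem and1_side_nonpos {q : ℝ} (hq0 : 0 < q) (hq1 : q ≤ 1) {E : Finset (Sym2 V)} (hE : IsTTSP E s t) (hst : s(s, t) ∉ E)
    (huv : s(u, v) ∈ E) {h : Finset (Sym2 V) → ℝ}
    (hmono : ∀ ⦃A B : Finset (Sym2 V)⦄, A ⊆ B → B ⊆ E.erase s(u, v) → h A ≤ h B) :
    ∑ γ ∈ (E.erase s(u, v)).powerset,
        (q ^ (clusterCount (↑(insert s(u, v) γ) : BondConfig V) ∅ + clusterCount (↑(E.erase s(u, v) \ γ) : BondConfig V) ∅) -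
            q ^ (clusterCount (↑(insert s(u, v) (E.erase s(u, v) \ γ)) : BondConfig V) ∅ + clusterCount (↑γ : BondConfig V) ∅)) * h γ ≤ 0 := by
  set N := E.erase s(u, v) with hN
  have huvN : s(u, v) ∉ N := Finset.notMem_erase _ _
  -- re-root `E ∪ {st}` at `uv`
  have hR : IsTTSP (E ∪ {s(s, t)}) u v :=
    hE.reroot (IsTTSP.edge hE.ne) (Finset.disjoint_singleton_right.2 hst) (fun z _ hz => by
      obtain ⟨e, he, hze⟩ := hz
      rw [Finset.mem_singleton] at he; subst he
      exact Sym2.mem_iff.1 hze) huv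
  have hNR : N ⊆ E ∪ {s(s, t)} := (Finset.erase_subset _ _).trans Finset.subset_union_left
  set G : Finset (Sym2 V) → ℝ := fun X => h (X ∩ N) with hG
  have hGmono : ∀ ⦃A B : Finset (Sym2 V)⦄, A ⊆ B → B ⊆ N → G A ≤ G B := fun A B hAB _ =>
    hmono (Finset.inter_subset_inter hAB le_rfl) Finset.inter_subset_right
  have hGy : ∀ A : Finset (Sym2 V), G (insert s(u, v) A) = G A := fun A => by
    simp only [hG, Finset.insert_inter_of_notMem huvN]
  have key := apPsi_edge_nonpos_of_isTTSP hq0 hq1 hR hNR huvN hGy hGmono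
  have hNS : Disjoint N {s(u, v)} := Finset.disjoint_singleton_right.2 huvN
  have hE' : insert s(u, v) N = N ∪ {s(u, v)} := by rw [union_singleton_eq_insert]
  have hf : (fun A : Finset (Sym2 V) => if s(u, v) ∈ A then (1 : ℝ) else 0) =
      fun A => if ({s(u, v)} : Finset (Sym2 V)) ⊆ A then 1 else 0 := by
    funext A; simp only [Finset.singleton_subset_iff]
  have hg' : ∀ A T : Finset (Sym2 V), T ⊆ {s(u, v)} → G (A ∪ T) = G A := by
    intro A T hT
    simp only [hG, Finset.union_inter_distrib_right]
    have : T ∩ N = ∅ := Finset.disjoint_iff_inter_eq_empty.1 (Finset.disjoint_of_subset_left hT hNS.symm)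
    rw [this, Finset.union_empty]
  rw [hE', hf, apPsi_andInd_eq q hNS ⟨s(u, v), Finset.mem_singleton_self _⟩ hg'] at key
  have hsum : ∑ γ ∈ N.powerset,
      (q ^ (clusterCount (↑(insert s(u, v) γ) : BondConfig V) ∅ + clusterCount (↑(N \ γ) : BondConfig V) ∅) - q ^ (clusterCount (↑(insert s(u, v) (N \ γ)) : BondConfig V) ∅ + clusterCount (↑γ : BondConfig V) ∅)) * h γ =
      ∑ γ ∈ N.powerset, (q ^ (clusterCount (↑(γ ∪ {s(u, v)}) : BondConfig V) ∅ + clusterCount (↑(N \ γ) : BondConfig V) ∅) -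
          q ^ (clusterCount (↑(N \ γ ∪ {s(u, v)}) : BondConfig V) ∅ + clusterCount (↑γ : BondConfig V) ∅)) * G γ := by
    refine Finset.sum_congr rfl fun γ hγ => ?_
    rw [Finset.mem_powerset] at hγ
    rw [union_singleton_eq_insert, union_singleton_eq_insert]
    simp only [hG, Finset.inter_eq_left.2 hγ]
  rw [hsum]
  linarith

end Sides

/-! ### `C_∞(and_S)` for the 3-edge path across a series junction -/

section Main

variable {a b m c d : V}

/-- **THEOREM (`C_∞` at level 3 for `S = P₄`, series junction).**  Let `A₁ = N₁ ∪ {ab}` be a two-terminal series–parallel network between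
`b` and `m` and `A₂ = N₂ ∪ {cd}` one between `m` and `c`, edge-disjoint, meeting only in the vertex `m`, with `b` off `A₂` and `c` off `A₁`, and
assume the junction edges `bm`, `mc` are absent (`bm ∉ A₁`, `mc ∉ A₂`).  Then for `H = A₁ ∪ A₂ ∪ {bc}` — a 2-connected series–parallel graph whose
`H \ bc` is the SERIES composition `A₁ · A₂` — the path `S = {ab, bc, cd} ⊆ H`, every `0 < q ≤ 1` and every increasing `g` not reading `S`:
`apPsi q H 1_{S ⊆ ·} g ≤ 0`, i.e. every square-free coefficient of `Z_H² Cov_{φ_{z,q}}(ω_{ab} ω_{bc} ω_{cd}, g)` is `≤ 0` — gen 10's Conjecture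
`C_∞` for the AND type on three edges forming a path, in the series case.  Proof: `apPsi_andInd_eq` + `and4_series_nonpos`, the side inputs
being gen 11's |W| = 3 theorem (`and2_side_nonpos`) and Theorem U at the end edges (`and1_side_nonpos`).
[cite: Grimmett2006, §3.8 Thm. (3.90) (pp. 61–62); §3.9 (pp. 63–64)] [cite: Wagner2006, Thm. 5.8(d), §5.3] -/
theorem apPsi_and_path3_series_nonpos {q : ℝ} (hq0 : 0 < q) (hq1 : q ≤ 1) {N₁ N₂ : Finset (Sym2 V)}
    (hA₁ : IsTTSP (insert s(a, b) N₁) b m) (hA₂ : IsTTSP (insert s(c, d) N₂) m c) (habN : s(a, b) ∉ N₁) (hcdN : s(c, d) ∉ N₂)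
    (hd : Disjoint (insert s(a, b) N₁) (insert s(c, d) N₂))
    (hV : ∀ z : V, (∃ e ∈ insert s(a, b) N₁, z ∈ e) → (∃ e ∈ insert s(c, d) N₂, z ∈ e) → z = m)
    (hbA₂ : ∀ e ∈ insert s(c, d) N₂, b ∉ e) (hcA₁ : ∀ e ∈ insert s(a, b) N₁, c ∉ e)
    (hbm : s(b, m) ∉ insert s(a, b) N₁) (hmc : s(m, c) ∉ insert s(c, d) N₂)
    {g : Finset (Sym2 V) → ℝ} (hg : ∀ A T : Finset (Sym2 V), T ⊆ {s(a, b), s(b, c), s(c, d)} → g (A ∪ T) = g A)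
    (hmono : ∀ ⦃A B : Finset (Sym2 V)⦄, A ⊆ B → B ⊆ N₁ ∪ N₂ → g A ≤ g B) :
    apPsi q (insert s(b, c) (insert s(a, b) N₁ ∪ insert s(c, d) N₂))
      (fun X => if ({s(a, b), s(b, c), s(c, d)} : Finset (Sym2 V)) ⊆ X then 1 else 0) g ≤ 0 := by
  -- distinctness
  have hbm' : b ≠ m := hA₁.ne
  have hcm' : c ≠ m := hA₂.ne.symm
  have hbc : b ≠ c := fun h => hbA₂ _ (Finset.mem_insert_self _ _) (h ▸ Sym2.mem_mk_left c d)
  -- vertex sets of the sides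
  set V₁ : Set V := {z | ∃ e ∈ insert s(a, b) N₁, z ∈ e} with hV₁
  set V₂ : Set V := {z | ∃ e ∈ insert s(c, d) N₂, z ∈ e} with hV₂
  have h₁ : ∀ e ∈ (↑(insert s(a, b) N₁) : Set (Sym2 V)), ∀ z ∈ e, z ∈ V₁ := fun e he z hz => ⟨e, he, hz⟩
  have h₂ : ∀ e ∈ (↑(insert s(c, d) N₂) : Set (Sym2 V)), ∀ z ∈ e, z ∈ V₂ := fun e he z hz => ⟨e, he, hz⟩
  have hS : V₁ ∩ V₂ ⊆ ({m} : Set V) := fun z hz => hV z hz.1 hz.2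
  have hbV₂ : b ∉ V₂ := fun ⟨e, he, hbe⟩ => hbA₂ e he hbe
  have hcV₁ : c ∉ V₁ := fun ⟨e, he, hce⟩ => hcA₁ e he hce
  have hdN : Disjoint N₁ N₂ :=
    Finset.disjoint_of_subset_left (Finset.subset_insert _ _) (Finset.disjoint_of_subset_right (Finset.subset_insert _ _) hd)
  -- `S` is disjoint from `N = N₁ ⊔ N₂`
  have hNS : Disjoint (N₁ ∪ N₂) ({s(a, b), s(b, c), s(c, d)} : Finset (Sym2 V)) := by
    refine Finset.disjoint_left.2 fun e he heS => ?_
    simp only [Finset.mem_insert, Finset.mem_singleton] at heS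
    rcases Finset.mem_union.1 he with h | h
    · rcases heS with rfl | rfl | rfl
      · exact habN h
      · exact hcA₁ _ (Finset.mem_insert_of_mem h) (Sym2.mem_mk_right b c)
      · exact hcA₁ _ (Finset.mem_insert_of_mem h) (Sym2.mem_mk_left c d)
    · rcases heS with rfl | rfl | rfl
      · exact hbA₂ _ (Finset.mem_insert_of_mem h) (Sym2.mem_mk_right a b)
      · exact hbA₂ _ (Finset.mem_insert_of_mem h) (Sym2.mem_mk_left b c)
      · exact hcdN h
  rw [← union_path3_eq N₁ N₂ a b c d, apPsi_andInd_eq q hNS ⟨s(a, b), Finset.mem_insert_self _ _⟩ hg]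
  -- the four side inputs
  have hY₁ : ∀ h' : Finset (Sym2 V) → ℝ, (∀ ⦃A B : Finset (Sym2 V)⦄, A ⊆ B → B ⊆ N₁ → h' A ≤ h' B) →
      ∑ γ₁ ∈ N₁.powerset, (q ^ (clusterCount (↑(insert s(b, m) (insert s(a, b) γ₁)) : BondConfig V) ∅ +
          clusterCount (↑(N₁ \ γ₁) : BondConfig V) ∅) -
        q ^ (clusterCount (↑(insert s(b, m) (insert s(a, b) (N₁ \ γ₁))) : BondConfig V) ∅ +
          clusterCount (↑γ₁ : BondConfig V) ∅)) * h' γ₁ ≤ 0 := by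
    intro h' hm
    have key := and2_side_nonpos hq0 hq1 hA₁ hbm (Finset.mem_insert_self _ _) (h := h')
      (by rw [Finset.erase_insert habN]; exact hm)
    rwa [Finset.erase_insert habN] at key
  have hU₁ : ∀ h' : Finset (Sym2 V) → ℝ, (∀ ⦃A B : Finset (Sym2 V)⦄, A ⊆ B → B ⊆ N₁ → h' A ≤ h' B) →
      ∑ γ₁ ∈ N₁.powerset, (q ^ (clusterCount (↑(insert s(a, b) γ₁) : BondConfig V) ∅ +
          clusterCount (↑(N₁ \ γ₁) : BondConfig V) ∅) -
        q ^ (clusterCount (↑(insert s(a, b) (N₁ \ γ₁)) : BondConfig V) ∅ + clusterCount (↑γ₁ : BondConfig V) ∅)) * h' γ₁ ≤ 0 := by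
    intro h' hm
    have key := and1_side_nonpos hq0 hq1 hA₁ hbm (Finset.mem_insert_self _ _) (h := h')
      (by rw [Finset.erase_insert habN]; exact hm)
    rwa [Finset.erase_insert habN] at key
  have hY₂ : ∀ h' : Finset (Sym2 V) → ℝ, (∀ ⦃A B : Finset (Sym2 V)⦄, A ⊆ B → B ⊆ N₂ → h' A ≤ h' B) →
      ∑ γ₂ ∈ N₂.powerset, (q ^ (clusterCount (↑(insert s(m, c) (insert s(c, d) γ₂)) : BondConfig V) ∅ +
          clusterCount (↑(N₂ \ γ₂) : BondConfig V) ∅) -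
        q ^ (clusterCount (↑(insert s(m, c) (insert s(c, d) (N₂ \ γ₂))) : BondConfig V) ∅ +
          clusterCount (↑γ₂ : BondConfig V) ∅)) * h' γ₂ ≤ 0 := by
    intro h' hm
    have key := and2_side_nonpos hq0 hq1 hA₂ hmc (Finset.mem_insert_self _ _) (h := h')
      (by rw [Finset.erase_insert hcdN]; exact hm)
    rwa [Finset.erase_insert hcdN] at key
  have hU₂ : ∀ h' : Finset (Sym2 V) → ℝ, (∀ ⦃A B : Finset (Sym2 V)⦄, A ⊆ B → B ⊆ N₂ → h' A ≤ h' B) →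
      ∑ γ₂ ∈ N₂.powerset, (q ^ (clusterCount (↑(insert s(c, d) γ₂) : BondConfig V) ∅ +
          clusterCount (↑(N₂ \ γ₂) : BondConfig V) ∅) -
        q ^ (clusterCount (↑(insert s(c, d) (N₂ \ γ₂)) : BondConfig V) ∅ + clusterCount (↑γ₂ : BondConfig V) ∅)) * h' γ₂ ≤ 0 := by
    intro h' hm
    have key := and1_side_nonpos hq0 hq1 hA₂ hmc (Finset.mem_insert_self _ _) (h := h')
      (by rw [Finset.erase_insert hcdN]; exact hm)
    rwa [Finset.erase_insert hcdN] at key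
  have main := and4_series_nonpos hq0 h₁ h₂ hS hbV₂ hcV₁ hbm' hcm' hbc (Finset.mem_insert_self _ _) (Finset.mem_insert_self _ _)
    hdN (Finset.subset_insert _ _) (Finset.subset_insert _ _) hY₁ hU₁ hY₂ hU₂ hmono
  linarith

end Main

end FK

end Summit.CriticalPhenomena.PercolationContinuityZ3.Theorems

end
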